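import Summits.QuantumFields.BalabanUV.Beta.FP.PeriodisedWardOrderOneTowerStep
import Summits.QuantumFields.BalabanUV.Beta.FP.TorusCompositeCovarianceOneRows
import Summits.QuantumFields.BalabanUV.Beta.FP.PeriodisedWardOrderOneCompanion

/-!
# `BalabanUV.Beta.FP.PeriodisedWardOrderOneTowerClosing` — road «FP» for binder row D1, ROUTE T (β1), the OWNER d1-p3's R-FP-74 (b) + W-FP-33-3:
# **THE TOWER's `a1` ROW, STOREY BY STOREY — PART 2: THE INDUCTION AND THE RECORD's COROLLARY** (companion sum = leaf-06's `compSumSym`, companions indexed by torus).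
# * §2 **`tower_a1_row_eq`** — for EVERY depth `n` and top `M`, storey data from the top (tori above `Ma k`, coefficient families `cf k`, weights `w k`, bond weights
#   `hb k`, covariance scales `κ k`), a companion family `G : ∀ T, Matrix …` identified storey by storey with the Λ-families (`hG k`, `k < n`), bottom data
#   (`H₀ = (perF T₀ (bhKStepAt d ρ L 0))|ff`, Wilson weight `cW`, bottom Λ table and direction at index `n`) and ANY family `φ` of periodic potentials on the finest
#   torus `T₀ = towerTorus Lc M n`: under the displayed bottom row (K1) and one (K1′)-type link per storey,
#   `((−2cW) • Σ_b hb n b • W_b|ff + HL_n + compSumSym Lc G M lev rs n) * of (∇φ) + H₀ * W₁[φ] = (compRowsSym Lc M lev rs n)ᵀ * (the top storey's raw endpoint readings)`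
#   — structural recursion on `n` (push-inside, `M` generalised, `G` fixed) over `…TowerStep.tower_a1_row_base ∕ _step`, leaf-02's `compRowsSym_mul_tgrad_mul` pattern.
# * §3 at the record (centred comb roots `fun _ => ctrOff (d+1) Lc`): `evalN_itRoot_wrapPt_root_eq_zero` (every nested mode vanishes at the iterated roots of a root
#   point — `PeriodisedWardOrderOneCompanion.tdelta_root_res_eq_zero` for the top modes, leaf-02 `evalN_itRoot_rootPt` for the lower ones), `evalN_translate`,
#   `towerGen_eq_of_grad` (leaf-06's generators ARE the gradient columns of the modes' potentials: leaf-02 `towerGen_eq_tgrad_mul_evalN` + `…Potentials.tgrad_ff_mul_eq_of_grad`),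
#   and **`tower_a1_row_towerGen_eq_zero`**: at `W₀ = towerGen Lc M ρs n`, `W₁ =` #21's `hW₁` shape, the top storey's endpoint readings VANISH ⟹
#   `((−2cW) • Σ_b hb n b • W_b|ff + HL_n + compSumSym Lc G M lev ρs n) * towerGen + H₀ * W₁ = 0` — the TOTAL first-order Ward row with one companion per storey
#   closes with `Y₁ = 0` under (K1) + the `n` links + the `hG k` (level 0 = `PeriodisedWardOrderOneCompanion.torus_a1_total_of_kkt_rows`' `H₁ + Q₁₀ᵀ G₁ Q₁₀` pattern;
#   the companions' ∕ links' identification with the dictionary's tables is the row's: Q-FP-33-1).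
# [folklore] bookkeeping BY NAME over OUR typed objects; no `def`, no `def … : Prop`, nothing cited, 0 sorry; 0 estimates; discharges NO row of the door by itself.

HONEST DEPENDENCY (page 1, mandatory): continuum YM on T⁴ ⇐ BetaPertH ∧ nine spine estimates (0/9 proved); BetaPertH ⇐ (D1) ∧ (D4) ∧ CAP+tail;
G-an2-4 gates asym, D1 and NE2/3/4.  HONEST FRAMING (cell contract, verbatim): «discharging `BetaPertH` makes Bałaban's UV stability UNCONDITIONAL —
a real constructive-QFT result; it is NOT the continuum limit and NOT the Clay problem.»  ABSOLUTE RULE (cell charter, verbatim): «No internally-minted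
statement may enter as a cited fact. Every hypothesis is either kernel-proved in this package or a verbatim quotation of a PUBLISHED theorem with page
reference. The manuscript(s) under audit are NOT citable for their own disputed steps — they are the thing under adjudication; programme-internal
(2001/route/tribunal) claims are never citable.»  Nothing of Bałaban's ∕ the dictionary's asserted; 0∕4 row-D1 binders (hW, hR, D1Tel, D1Rep); ROOT M‴ p325680
untouched; NOT (C1), NOT (T-ID), NOT SDF, NOT D1, NEVER «G-an2-4 closed», NOT BetaPertH, NOT continuum, NOT Clay.  «not in print; our bookkeeping».
Unit `b2b-balaban-beta-d1-formalise-leaf-05` (gen 44), 2026-08-24; no existing file touched.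
-/

noncomputable section

namespace Summit.QuantumFields.BalabanUV.Beta.FP.PeriodisedWardOrderOneTowerClosing

open scoped BigOperators Matrix
open Finset Matrix
open Literature.MathematicalPhysics.QuantumFieldTheory.Balaban1983to89
open Literature.MathematicalPhysics.QuantumFieldTheory.Balaban1983to89.Beta
open B4TorusKernel.MultiPeriod (translate translate_apply)
open B5Prop11Plancherel (fine)
open B6Lemma24Torus (pbox mem_pbox wrap wrap_eq_self wrap_congr)
open ExpKernelCalculus (MKer)
open AffineAveraging (Site box toSite unitVec)
open AveragingContoursRooted (ctr ctrOff ctrOff_mem_box)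
open OneStepResolventKernel (Fib)
open InterLevelTransport (SLam)
open StepJetData (wilsonA)
open Summit.QuantumFields.BalabanUV.Beta.SymAveragingHessianCounts (symHessFFAt symLinKerAt)
open Summit.QuantumFields.BalabanUV.Beta.BorderedHessian (bhKStepAt stepScale)
open Summit.QuantumFields.BalabanUV.Beta.DshAn1 (Dsh)
open Summit.QuantumFields.BalabanUV.Beta.SymShiftedSpread (bhKStepSh)
open Summit.QuantumFields.BalabanUV.Beta.FP.KernelPeriodisationFib (Idx perF perF_apply perZ perZ_apply)
open Summit.QuantumFields.BalabanUV.Beta.FP.KernelPeriodisationFibLoc (dper)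
open Summit.QuantumFields.BalabanUV.Beta.FP.TorusGaugeCovariance (tdelta tgrad tgrad_inl)
open Summit.QuantumFields.BalabanUV.Beta.FP.TorusGaugeCovarianceCoarse (coarsePt coarsePt_coe)
open Summit.QuantumFields.BalabanUV.Beta.FP.TorusGaugeCovariancePairing (wrapPt wrapPt_coe wrapPt_of_mem)
open Summit.QuantumFields.BalabanUV.Beta.FP.TorusCompositeObjects (towerTorus towerTorus_apply towerTorus_zero)
open Summit.QuantumFields.BalabanUV.Beta.FP.TorusCompositeObjectsG (QstepSym compRowsSym compRowsSym_zero compRowsSym_succ)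
open Summit.QuantumFields.BalabanUV.Beta.FP.TorusCompositeCovariance (rootPt rootPt_coe itRoot itRoot_zero itRoot_succ)
open Summit.QuantumFields.BalabanUV.Beta.FP.TorusCompositeCovarianceSym (compRowsSym_mul_tgrad_mul)
open Summit.QuantumFields.BalabanUV.Beta.FP.TorusCompositeCompanionSumG (onTower compSumG compSumSym compSumSym_zero compSumSym_succ)
open Summit.QuantumFields.BalabanUV.Beta.FP.PeriodisedWardOrderOnePotentials (torus_a1_wilson_potentials tgrad_ff_mul_eq_of_grad wrapPt_translate wrapPt_coe_eq)
open Summit.QuantumFields.BalabanUV.Beta.FP.PeriodisedWardOrderOneStoreys (torus_lamFamily_mul_grad_potentials_split rawRem_eq_neg_smul_transpose_mul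
  itRoot_wrapPt_succ)
open Summit.QuantumFields.BalabanUV.Beta.FP.TorusCompositeObjects (NParam towerGen bigRatio bigRatio_eq_pow)
open Summit.QuantumFields.BalabanUV.Beta.FP.TorusCompositeCovariance (quo_itRoot)
open Summit.QuantumFields.BalabanUV.Beta.FP.TorusCompositeFP (evalN evalN_zero evalN_succ)
open Summit.QuantumFields.BalabanUV.Beta.FP.TorusCompositeCovarianceOne (tdelta_wrapPt)
open Summit.QuantumFields.BalabanUV.Beta.FP.TorusCompositeCovarianceOneRows (towerGen_eq_tgrad_mul_evalN evalN_congr evalN_itRoot_rootPt)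
open Summit.QuantumFields.BalabanUV.Beta.FP.PeriodisedWardOrderOneCompanion (tdelta_root_res_eq_zero)
open Literature.MathematicalPhysics.QuantumFieldTheory.LatticeForm (quo)
open Summit.QuantumFields.BalabanUV.Beta.FP.PeriodisedWardOrderOneTowerStep (apply_wrapPt_of_periodic tower_a1_row_base tower_a1_row_step)

variable {d : ℕ} (Lc : ℕ) [NeZero Lc] (N : ℕ)

/-! ## §2 THE TOWER's `a1` ROW, STOREY BY STOREY (top-peel induction; columns = gradients of arbitrary periodic potentials on the finest torus) -/

/-- **[folklore] `tower_a1_row_eq` — THE DEPTH-`n` TOWER's FIRST-ORDER WARD ROW WITH ONE COMPANION PER STOREY IS THE TOP STOREY's ENDPOINT READINGS PULLED BACK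
THROUGH THE COMPOSITE ROWS.**  Top `M`, finest `T₀ = towerTorus Lc M n`; storey data FROM THE TOP (`Ma k` = the torus above storey `k` with `hMa`; coefficient families
`cf k` summable along the `Ma k`-copies; weights `w k`; bond weights `hb k` on `towerTorus Lc M k`; covariance scales `κ k` with `κ n = 1`, `κ k = stepScale d Lc (lev (k+1))·#B·κ (k+1)`);
the companions `G (towerTorus Lc M k)`, `k < n`, of leaf-06's `compSumSym Lc G M lev rs n` identified with the storeys' periodised Λ-families (`hG`); bottom: Wilson weight
`cW`, form block `H₀ = (perF T₀ (bhKStepAt d ρ L 0))|ff`, the bottom Λ table `HL_n` and direction `hb n`; columns: the gradients of ANY family `φ` of `T₀`-periodic potentials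
and the first jet `W₁ = of (b e ↦ −(cW·hb n b·φ_e(b⁺)))`.  HYPOTHESES (displayed — the nested column's KKT letters, the assembly's ∕ the dictionary's): (K1)
`cW·(H₀ hb n)_v = w n · N̂_n(v)` on every finest bond; (LINK k), `k < n`: `w k·κ k·N̂_k(a) = (w (k+1)·κ (k+1) ∕ (stepScale d Lc (lev (k+1))·Lc^{d+1}))·Λ_{k+1}(a)` on every
storey-`k` bond.  CONCLUSION: `((−2cW) • Σ_b hb n b • W_b|ff + HL_n + compSumSym Lc G M lev rs n) * of (∇φ) + H₀ * W₁ = (compRowsSym Lc M lev rs n)ᵀ * of (a e ↦ −(w 0·κ 0)·Σ_ā hb 0 ā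
Σ_μ Σ'_y c₀^per · ((φ_e ∘ itRoot_n ∘ wrapPt M)(Lc•y+ρ_c) + (…)(Lc•y+ρ_c+Lc•e_μ)) · q¹_{(μ,y)}(a) ∕ 2)` — the top storey's endpoint readings (they vanish at the record's top: §3). -/
theorem tower_a1_row_eq (hc : ctrOff (d + 1) Lc ∈ box (d + 1) Lc) [NeZero N] (G : (T : Fin (d + 1) → ℕ) → Matrix (↥(pbox T) × Fin (d + 1)) (↥(pbox T) × Fin (d + 1)) ℝ) :
    ∀ (n : ℕ) (M : Fin (d + 1) → ℕ) [∀ μ, NeZero (M μ)] (lev : ℕ → ℕ) (rs : ℕ → (Fin (d + 1) → ℕ))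
      (Ma : ℕ → (Fin (d + 1) → ℕ)) (_hMa : ∀ k i, towerTorus Lc M k i = Lc * Ma k i)
      (cf : ℕ → (Fin (d + 1) → Site (d + 1) → Fin (d + 1) → Site (d + 1) → ℝ))
      (_hcf : ∀ k κ' u μ y, Summable fun m : Site (d + 1) => cf k μ (translate (Ma k) y m) κ' u)
      (w κ : ℕ → ℝ) (_hκ : ∀ k, k < n → κ k = stepScale d Lc (lev (k + 1)) * ((box (d + 1) Lc).card : ℝ) * κ (k + 1)) (_hκn : κ n = 1)
      (hb : (k : ℕ) → (↥(pbox (towerTorus Lc M k)) × Fin (d + 1) → ℝ))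
      (_hG : ∀ k, k < n → G (towerTorus Lc M k)
        = w k • ∑ ā : ↥(pbox (towerTorus Lc M k)) × Fin (d + 1), hb k ā •
            (perF (towerTorus Lc M k) (dper (towerTorus Lc M k) (SLam N (cf k) (fun μ y => symHessFFAt (toSite (ctrOff (d + 1) Lc)) Lc μ y) ā.2 (ā.1 : Site (d + 1))))).submatrix
              (fun b : ↥(pbox (towerTorus Lc M k)) × Fin (d + 1) => ((b.1, Sum.inl b.2) : Idx (towerTorus Lc M k) (Fib d)))
              (fun b : ↥(pbox (towerTorus Lc M k)) × Fin (d + 1) => ((b.1, Sum.inl b.2) : Idx (towerTorus Lc M k) (Fib d))))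
      (ρ : Site (d + 1)) (L : ℕ) [NeZero L] (cW : ℝ)
      {γ : Type*} (φ : γ → Site (d + 1) → ℝ) (_hφ : ∀ e z m, φ e (translate (towerTorus Lc M n) z m) = φ e z)
      (_K1 : ∀ v : ↥(pbox (towerTorus Lc M n)) × Fin (d + 1),
        cW * ((perF (towerTorus Lc M n) (bhKStepAt d ρ L 0)).submatrix
          (fun b : ↥(pbox (towerTorus Lc M n)) × Fin (d + 1) => ((b.1, Sum.inl b.2) : Idx (towerTorus Lc M n) (Fib d)))
          (fun b : ↥(pbox (towerTorus Lc M n)) × Fin (d + 1) => ((b.1, Sum.inl b.2) : Idx (towerTorus Lc M n) (Fib d)))).mulVec (hb n) v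
          = w n * ∑ ā : ↥(pbox (towerTorus Lc M n)) × Fin (d + 1), hb n ā *
            ∑ μ : Fin (d + 1), ∑' y : Site (d + 1), (∑' m : Site (d + 1), cf n μ (translate (Ma n) y m) ā.2 (ā.1 : Site (d + 1)))
              * symLinKerAt (toSite (ctrOff (d + 1) Lc)) Lc μ y (v.2, (v.1 : Site (d + 1))))
      (_hlink : ∀ k, k < n → ∀ a : ↥(pbox (towerTorus Lc M k)) × Fin (d + 1),
        w k * κ k * (∑ ā : ↥(pbox (towerTorus Lc M k)) × Fin (d + 1), hb k ā *
            ∑ μ : Fin (d + 1), ∑' y : Site (d + 1), (∑' m : Site (d + 1), cf k μ (translate (Ma k) y m) ā.2 (ā.1 : Site (d + 1)))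
              * symLinKerAt (toSite (ctrOff (d + 1) Lc)) Lc μ y (a.2, (a.1 : Site (d + 1))))
          = w (k + 1) * κ (k + 1) / (stepScale d Lc (lev (k + 1)) * (Lc : ℝ) ^ (d + 1)) *
            ∑ ā : ↥(pbox (towerTorus Lc M (k + 1))) × Fin (d + 1), hb (k + 1) ā *
              ∑' m : Site (d + 1), cf (k + 1) a.2 (translate (towerTorus Lc M k) (a.1 : Site (d + 1)) m) ā.2 (ā.1 : Site (d + 1))),
      (((-2 * cW) • ∑ b : ↥(pbox (towerTorus Lc M n)) × Fin (d + 1), hb n b •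
          (perF (towerTorus Lc M n) (dper (towerTorus Lc M n) (wilsonA d b.2 (b.1 : Site (d + 1))))).submatrix
            (fun b : ↥(pbox (towerTorus Lc M n)) × Fin (d + 1) => ((b.1, Sum.inl b.2) : Idx (towerTorus Lc M n) (Fib d)))
            (fun b : ↥(pbox (towerTorus Lc M n)) × Fin (d + 1) => ((b.1, Sum.inl b.2) : Idx (towerTorus Lc M n) (Fib d))))
          + w n • ∑ ā : ↥(pbox (towerTorus Lc M n)) × Fin (d + 1), hb n ā •
            (perF (towerTorus Lc M n) (dper (towerTorus Lc M n) (SLam N (cf n) (fun μ y => symHessFFAt (toSite (ctrOff (d + 1) Lc)) Lc μ y) ā.2 (ā.1 : Site (d + 1))))).submatrix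
              (fun b : ↥(pbox (towerTorus Lc M n)) × Fin (d + 1) => ((b.1, Sum.inl b.2) : Idx (towerTorus Lc M n) (Fib d)))
              (fun b : ↥(pbox (towerTorus Lc M n)) × Fin (d + 1) => ((b.1, Sum.inl b.2) : Idx (towerTorus Lc M n) (Fib d)))
          + compSumSym Lc G M lev rs n)
          * Matrix.of (fun (v : ↥(pbox (towerTorus Lc M n)) × Fin (d + 1)) (e : γ) =>
            φ e ((v.1 : Site (d + 1)) + unitVec v.2) - φ e (v.1 : Site (d + 1)))
        + (perF (towerTorus Lc M n) (bhKStepAt d ρ L 0)).submatrix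
          (fun b : ↥(pbox (towerTorus Lc M n)) × Fin (d + 1) => ((b.1, Sum.inl b.2) : Idx (towerTorus Lc M n) (Fib d)))
          (fun b : ↥(pbox (towerTorus Lc M n)) × Fin (d + 1) => ((b.1, Sum.inl b.2) : Idx (towerTorus Lc M n) (Fib d)))
          * Matrix.of (fun (b : ↥(pbox (towerTorus Lc M n)) × Fin (d + 1)) (e : γ) =>
            -(cW * hb n b * φ e ((b.1 : Site (d + 1)) + unitVec b.2)))
      = (compRowsSym Lc M lev rs n)ᵀ * Matrix.of (fun (a : ↥(pbox (M)) × Fin (d + 1)) (e : γ) =>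
          -(w 0 * κ 0 * ∑ ā : ↥(pbox (M)) × Fin (d + 1), hb 0 ā *
            ∑ μ : Fin (d + 1), ∑' y : Site (d + 1), (∑' m : Site (d + 1), cf 0 μ (translate (Ma 0) y m) ā.2 (ā.1 : Site (d + 1)))
              * ((φ e ((itRoot Lc (M) (fun _ => ctrOff (d + 1) Lc) (fun _ => hc) n (wrapPt (M) ((Lc : ℤ) • y + toSite (ctrOff (d + 1) Lc))) : ↥(pbox (towerTorus Lc (M) n))) : Site (d + 1))
                    + φ e ((itRoot Lc (M) (fun _ => ctrOff (d + 1) Lc) (fun _ => hc) n (wrapPt (M) ((Lc : ℤ) • y + toSite (ctrOff (d + 1) Lc) + (Lc : ℤ) • unitVec μ)) : ↥(pbox (towerTorus Lc (M) n))) : Site (d + 1)))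
                  * symLinKerAt (toSite (ctrOff (d + 1) Lc)) Lc μ y (a.2, (a.1 : Site (d + 1))) / 2)))
  | 0, M, _, _, _, _, hMa, cf, hcf, w, κ, _, hκn, hb, _, ρ, L, _, cW, _, φ, hφ, K1, _ =>
    tower_a1_row_base Lc N hc M (hMa 0) (cf 0) (hcf 0) (w 0) (κ 0) hκn (hb 0) ρ L cW φ hφ K1
  | n + 1, M, _, lev, rs, Ma, hMa, cf, hcf, w, κ, hκ, hκn, hb, hG, ρ, L, _, cW, _, φ, hφ, K1, hlink =>
    tower_a1_row_step Lc N hc n M lev rs Ma hMa cf hcf w κ hκ hκn hb G (hG 0 (Nat.succ_pos n)) ρ L cW φ hφ hlink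
      (tower_a1_row_eq hc G n (fine Lc M) (fun k => lev (k + 1)) (fun k => rs (k + 1)) (fun k => Ma (k + 1)) (fun k => hMa (k + 1))
        (fun k => cf (k + 1)) (fun k => hcf (k + 1)) (fun k => w (k + 1)) (fun k => κ (k + 1)) (fun k hk => hκ (k + 1) (Nat.succ_lt_succ hk)) hκn
        (fun k => hb (k + 1)) (fun k hk => hG (k + 1) (Nat.succ_lt_succ hk)) ρ L cW φ hφ K1 (fun k hk => hlink (k + 1) (Nat.succ_lt_succ hk)))

/-! ## §3 AT THE RECORD: the columns are leaf-06's tower generators (centred comb roots), and the top remainder VANISHES -/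

/-- **[folklore] `evalN_itRoot_wrapPt_root_eq_zero`** — every nested mode of the tower (centred comb roots, `Lc ∣ M`) VANISHES at the iterated centred root of the
representative of a root point `Lc•y + ρ_c + Lc•v` of the top torus: top modes by `PeriodisedWardOrderOneCompanion.tdelta_root_res_eq_zero` (`quo_itRoot`,
`tdelta_wrapPt`), lower modes by leaf-02's `evalN_itRoot_rootPt`. -/
theorem evalN_itRoot_wrapPt_root_eq_zero (hc : ctrOff (d + 1) Lc ∈ box (d + 1) Lc) :
    ∀ (n : ℕ) (M : Fin (d + 1) → ℕ) [∀ μ, NeZero (M μ)] (_hM : ∀ i, Lc ∣ M i) (y v : Site (d + 1))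
      (e : NParam Lc M (fun _ => ctrOff (d + 1) Lc) n),
      evalN Lc M (fun _ => ctrOff (d + 1) Lc) n (fun z : Site (d + 1) => z)
          ((itRoot Lc M (fun _ => ctrOff (d + 1) Lc) (fun _ => hc) n
              (wrapPt M ((Lc : ℤ) • y + toSite (ctrOff (d + 1) Lc) + (Lc : ℤ) • v)) : ↥(pbox (towerTorus Lc M n))) : Site (d + 1)) e = 0
  | 0, M, _, hM, y, v, t => by
    simp only [evalN_zero, Matrix.of_apply, itRoot_zero, tdelta_wrapPt]
    exact tdelta_root_res_eq_zero M Lc hM y v t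
  | k + 1, M, _, hM, y, v, Sum.inl t => by
    simp only [evalN_succ, Matrix.fromCols_apply_inl, Matrix.of_apply, bigRatio_eq_pow, quo_itRoot, tdelta_wrapPt]
    exact tdelta_root_res_eq_zero M Lc hM y v t
  | k + 1, M, _, _, y, v, Sum.inr e => by
    simp only [evalN_succ, Matrix.fromCols_apply_inr, itRoot_succ]
    rw [evalN_congr Lc k (fine Lc M) (fun _ => ctrOff (d + 1) Lc) (fun z : Site (d + 1) => z)
      (fun s : ↥(pbox (towerTorus Lc (fine Lc M) k)) => (s : Site (d + 1))) _
      (itRoot Lc (fine Lc M) (fun _ => ctrOff (d + 1) Lc) (fun _ => hc) k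
        (rootPt M Lc hc (wrapPt M ((Lc : ℤ) • y + toSite (ctrOff (d + 1) Lc) + (Lc : ℤ) • v)))) (fun i => ⟨0, by simp⟩) e]
    exact evalN_itRoot_rootPt Lc k M (fun _ => ctrOff (d + 1) Lc) (fun _ => hc) _ e

/-- [folklore] the nested modes' potentials `ψ_e := evalN … (fun z => z) · e` are periodic for the finest torus (`evalN_congr`). -/
theorem evalN_translate (n : ℕ) (M : Fin (d + 1) → ℕ) [∀ μ, NeZero (M μ)] (rs : ℕ → (Fin (d + 1) → ℕ)) (z m : Site (d + 1))
    (e : NParam Lc M rs n) :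
    evalN Lc M rs n (fun z : Site (d + 1) => z) (translate (towerTorus Lc M n) z m) e = evalN Lc M rs n (fun z : Site (d + 1) => z) z e :=
  evalN_congr Lc n M rs (fun z : Site (d + 1) => z) (fun z : Site (d + 1) => z) _ _ (fun i => ⟨m i, by rw [translate_apply]; ring⟩) e

/-- [folklore] **leaf-06's tower generators ARE the gradient columns of the modes' potentials** (`towerGen_eq_tgrad_mul_evalN` + `…Potentials.tgrad_ff_mul_eq_of_grad`,
the representative does not matter by `evalN_congr`). -/
theorem towerGen_eq_of_grad (n : ℕ) (M : Fin (d + 1) → ℕ) [∀ μ, NeZero (M μ)] (rs : ℕ → (Fin (d + 1) → ℕ)) :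
    towerGen Lc M rs n = Matrix.of (fun (v : ↥(pbox (towerTorus Lc M n)) × Fin (d + 1)) (e : NParam Lc M rs n) =>
      evalN Lc M rs n (fun z : Site (d + 1) => z) ((v.1 : Site (d + 1)) + unitVec v.2) e
        - evalN Lc M rs n (fun z : Site (d + 1) => z) (v.1 : Site (d + 1)) e) := by
  rw [towerGen_eq_tgrad_mul_evalN, tgrad_ff_mul_eq_of_grad]
  ext v e
  rw [Matrix.of_apply, Matrix.of_apply, wrapPt_coe_eq,
    evalN_congr Lc n M rs (fun s : ↥(pbox (towerTorus Lc M n)) => (s : Site (d + 1))) (fun z : Site (d + 1) => z)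
      (wrapPt (towerTorus Lc M n) ((v.1 : Site (d + 1)) + unitVec v.2)) ((v.1 : Site (d + 1)) + unitVec v.2) (fun i => ?_) e,
    evalN_congr Lc n M rs (fun s : ↥(pbox (towerTorus Lc M n)) => (s : Site (d + 1))) (fun z : Site (d + 1) => z)
      v.1 (v.1 : Site (d + 1)) (fun i => ⟨0, by simp⟩) e]
  refine ⟨-((((v.1 : Site (d + 1)) + unitVec v.2) i) / (towerTorus Lc M n i : ℤ)), ?_⟩
  rw [wrapPt_coe]
  simp only [wrap]
  rw [Int.emod_def]
  ring

/-- **[folklore] `tower_a1_row_towerGen_eq_zero` — THE TOWER's `a1` ROW AT THE RECORD's COLUMNS CLOSES TO ZERO.**  `tower_a1_row_eq` at the nested modes'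
potentials `ψ_e := evalN Lc M ρs n (fun z => z) · e` (centred comb roots `ρs := fun _ => ctrOff (d+1) Lc`): the columns are `towerGen Lc M ρs n` (#21's `hW₀`),
the first jet is #21's `hW₁` shape, and the top storey's endpoint readings VANISH (every mode is zero at the iterated roots of a root point, `Lc ∣ M` from `hMa 0`):
`((−2cW) • Σ_b hb n b • W_b|ff + HL_n + compSumSym Lc G M lev ρs n) * towerGen Lc M ρs n + H₀ * W₁ = 0` — the TOTAL first-order Ward row with one companion per
storey, `Y₁ = 0`, UNDER the displayed (K1), the `n` links and the companions' identifications `hG` (R-FP-74 (b); which tables instantiate them is the row's — Q-FP-33-1). -/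
theorem tower_a1_row_towerGen_eq_zero (hc : ctrOff (d + 1) Lc ∈ box (d + 1) Lc) [NeZero N] (G : (T : Fin (d + 1) → ℕ) → Matrix (↥(pbox T) × Fin (d + 1)) (↥(pbox T) × Fin (d + 1)) ℝ) (n : ℕ) (M : Fin (d + 1) → ℕ) [∀ μ, NeZero (M μ)]
    (lev : ℕ → ℕ) (Ma : ℕ → (Fin (d + 1) → ℕ)) (hMa : ∀ k i, towerTorus Lc M k i = Lc * Ma k i)
    (cf : ℕ → (Fin (d + 1) → Site (d + 1) → Fin (d + 1) → Site (d + 1) → ℝ))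
    (hcf : ∀ k κ' u μ y, Summable fun m : Site (d + 1) => cf k μ (translate (Ma k) y m) κ' u)
    (w κ : ℕ → ℝ) (hκ : ∀ k, k < n → κ k = stepScale d Lc (lev (k + 1)) * ((box (d + 1) Lc).card : ℝ) * κ (k + 1)) (hκn : κ n = 1)
    (hb : (k : ℕ) → (↥(pbox (towerTorus Lc M k)) × Fin (d + 1) → ℝ))
    (hG : ∀ k, k < n → G (towerTorus Lc M k)
      = w k • ∑ ā : ↥(pbox (towerTorus Lc M k)) × Fin (d + 1), hb k ā •
            (perF (towerTorus Lc M k) (dper (towerTorus Lc M k) (SLam N (cf k) (fun μ y => symHessFFAt (toSite (ctrOff (d + 1) Lc)) Lc μ y) ā.2 (ā.1 : Site (d + 1))))).submatrix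
              (fun b : ↥(pbox (towerTorus Lc M k)) × Fin (d + 1) => ((b.1, Sum.inl b.2) : Idx (towerTorus Lc M k) (Fib d)))
              (fun b : ↥(pbox (towerTorus Lc M k)) × Fin (d + 1) => ((b.1, Sum.inl b.2) : Idx (towerTorus Lc M k) (Fib d))))
    (ρ : Site (d + 1)) (L : ℕ) [NeZero L] (cW : ℝ)
    (K1 : ∀ v : ↥(pbox (towerTorus Lc M n)) × Fin (d + 1),
      cW * ((perF (towerTorus Lc M n) (bhKStepAt d ρ L 0)).submatrix
          (fun b : ↥(pbox (towerTorus Lc M n)) × Fin (d + 1) => ((b.1, Sum.inl b.2) : Idx (towerTorus Lc M n) (Fib d)))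
          (fun b : ↥(pbox (towerTorus Lc M n)) × Fin (d + 1) => ((b.1, Sum.inl b.2) : Idx (towerTorus Lc M n) (Fib d)))).mulVec (hb n) v
        = w n * ∑ ā : ↥(pbox (towerTorus Lc M n)) × Fin (d + 1), hb n ā *
            ∑ μ : Fin (d + 1), ∑' y : Site (d + 1), (∑' m : Site (d + 1), cf n μ (translate (Ma n) y m) ā.2 (ā.1 : Site (d + 1)))
              * symLinKerAt (toSite (ctrOff (d + 1) Lc)) Lc μ y (v.2, (v.1 : Site (d + 1))))
    (hlink : ∀ k, k < n → ∀ a : ↥(pbox (towerTorus Lc M k)) × Fin (d + 1),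
      w k * κ k * (∑ ā : ↥(pbox (towerTorus Lc M k)) × Fin (d + 1), hb k ā *
            ∑ μ : Fin (d + 1), ∑' y : Site (d + 1), (∑' m : Site (d + 1), cf k μ (translate (Ma k) y m) ā.2 (ā.1 : Site (d + 1)))
              * symLinKerAt (toSite (ctrOff (d + 1) Lc)) Lc μ y (a.2, (a.1 : Site (d + 1))))
        = w (k + 1) * κ (k + 1) / (stepScale d Lc (lev (k + 1)) * (Lc : ℝ) ^ (d + 1)) *
          ∑ ā : ↥(pbox (towerTorus Lc M (k + 1))) × Fin (d + 1), hb (k + 1) ā *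
            ∑' m : Site (d + 1), cf (k + 1) a.2 (translate (towerTorus Lc M k) (a.1 : Site (d + 1)) m) ā.2 (ā.1 : Site (d + 1))) :
    (((-2 * cW) • ∑ b : ↥(pbox (towerTorus Lc M n)) × Fin (d + 1), hb n b •
          (perF (towerTorus Lc M n) (dper (towerTorus Lc M n) (wilsonA d b.2 (b.1 : Site (d + 1))))).submatrix
            (fun b : ↥(pbox (towerTorus Lc M n)) × Fin (d + 1) => ((b.1, Sum.inl b.2) : Idx (towerTorus Lc M n) (Fib d)))
            (fun b : ↥(pbox (towerTorus Lc M n)) × Fin (d + 1) => ((b.1, Sum.inl b.2) : Idx (towerTorus Lc M n) (Fib d))))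
        + w n • ∑ ā : ↥(pbox (towerTorus Lc M n)) × Fin (d + 1), hb n ā •
            (perF (towerTorus Lc M n) (dper (towerTorus Lc M n) (SLam N (cf n) (fun μ y => symHessFFAt (toSite (ctrOff (d + 1) Lc)) Lc μ y) ā.2 (ā.1 : Site (d + 1))))).submatrix
              (fun b : ↥(pbox (towerTorus Lc M n)) × Fin (d + 1) => ((b.1, Sum.inl b.2) : Idx (towerTorus Lc M n) (Fib d)))
              (fun b : ↥(pbox (towerTorus Lc M n)) × Fin (d + 1) => ((b.1, Sum.inl b.2) : Idx (towerTorus Lc M n) (Fib d)))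
        + compSumSym Lc G M lev (fun _ => ctrOff (d + 1) Lc) n)
        * towerGen Lc M (fun _ => ctrOff (d + 1) Lc) n
      + (perF (towerTorus Lc M n) (bhKStepAt d ρ L 0)).submatrix
          (fun b : ↥(pbox (towerTorus Lc M n)) × Fin (d + 1) => ((b.1, Sum.inl b.2) : Idx (towerTorus Lc M n) (Fib d)))
          (fun b : ↥(pbox (towerTorus Lc M n)) × Fin (d + 1) => ((b.1, Sum.inl b.2) : Idx (towerTorus Lc M n) (Fib d)))
        * Matrix.of (fun (b : ↥(pbox (towerTorus Lc M n)) × Fin (d + 1)) (e : NParam Lc M (fun _ => ctrOff (d + 1) Lc) n) =>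
            -(cW * hb n b * evalN Lc M (fun _ => ctrOff (d + 1) Lc) n
              (fun b' : ↥(pbox (towerTorus Lc M n)) × Fin (d + 1) => (b'.1 : Site (d + 1)) + unitVec b'.2) b e))
      = 0 := by
  have hM : ∀ i, Lc ∣ M i := fun i => ⟨Ma 0 i, hMa 0 i⟩
  -- the first jet through the point potentials
  have hW₁ : (Matrix.of (fun (b : ↥(pbox (towerTorus Lc M n)) × Fin (d + 1)) (e : NParam Lc M (fun _ => ctrOff (d + 1) Lc) n) =>
        -(cW * hb n b * evalN Lc M (fun _ => ctrOff (d + 1) Lc) n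
          (fun b' : ↥(pbox (towerTorus Lc M n)) × Fin (d + 1) => (b'.1 : Site (d + 1)) + unitVec b'.2) b e)))
      = Matrix.of (fun (b : ↥(pbox (towerTorus Lc M n)) × Fin (d + 1)) (e : NParam Lc M (fun _ => ctrOff (d + 1) Lc) n) =>
        -(cW * hb n b * evalN Lc M (fun _ => ctrOff (d + 1) Lc) n (fun z : Site (d + 1) => z) ((b.1 : Site (d + 1)) + unitVec b.2) e)) := by
    ext b e
    rw [Matrix.of_apply, Matrix.of_apply,
      evalN_congr Lc n M (fun _ => ctrOff (d + 1) Lc) (fun b' : ↥(pbox (towerTorus Lc M n)) × Fin (d + 1) => (b'.1 : Site (d + 1)) + unitVec b'.2)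
        (fun z : Site (d + 1) => z) b ((b.1 : Site (d + 1)) + unitVec b.2) (fun i => ⟨0, by simp⟩) e]
  rw [towerGen_eq_of_grad, hW₁,
    tower_a1_row_eq Lc N hc G n M lev (fun _ => ctrOff (d + 1) Lc) Ma hMa cf hcf w κ hκ hκn hb hG ρ L cW
      (fun (e : NParam Lc M (fun _ => ctrOff (d + 1) Lc) n) (z : Site (d + 1)) => evalN Lc M (fun _ => ctrOff (d + 1) Lc) n (fun z : Site (d + 1) => z) z e)
      (fun e z m => evalN_translate Lc n M (fun _ => ctrOff (d + 1) Lc) z m e) K1 hlink]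
  -- the top storey's endpoint readings vanish on every mode
  have hz : ∀ (e : NParam Lc M (fun _ => ctrOff (d + 1) Lc) n) (y v : Site (d + 1)),
      evalN Lc M (fun _ => ctrOff (d + 1) Lc) n (fun z : Site (d + 1) => z) ((itRoot Lc (M) (fun _ => ctrOff (d + 1) Lc) (fun _ => hc) n (wrapPt (M) ((Lc : ℤ) • y + toSite (ctrOff (d + 1) Lc) + (Lc : ℤ) • v)) : ↥(pbox (towerTorus Lc (M) n))) : Site (d + 1)) e = 0 :=
    fun e y v => evalN_itRoot_wrapPt_root_eq_zero Lc hc n M hM y v e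
  have hz' : ∀ (e : NParam Lc M (fun _ => ctrOff (d + 1) Lc) n) (y : Site (d + 1)),
      evalN Lc M (fun _ => ctrOff (d + 1) Lc) n (fun z : Site (d + 1) => z) ((itRoot Lc (M) (fun _ => ctrOff (d + 1) Lc) (fun _ => hc) n (wrapPt (M) ((Lc : ℤ) • y + toSite (ctrOff (d + 1) Lc))) : ↥(pbox (towerTorus Lc (M) n))) : Site (d + 1)) e = 0 := fun e y => by
    simpa only [smul_zero, add_zero] using hz e y 0
  have h0 : (Matrix.of (fun (a : ↥(pbox M) × Fin (d + 1)) (e : NParam Lc M (fun _ => ctrOff (d + 1) Lc) n) =>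
      -(w 0 * κ 0 * ∑ ā : ↥(pbox M) × Fin (d + 1), hb 0 ā *
        ∑ μ : Fin (d + 1), ∑' y : Site (d + 1), (∑' m : Site (d + 1), cf 0 μ (translate (Ma 0) y m) ā.2 (ā.1 : Site (d + 1)))
          * ((evalN Lc M (fun _ => ctrOff (d + 1) Lc) n (fun z : Site (d + 1) => z) ((itRoot Lc (M) (fun _ => ctrOff (d + 1) Lc) (fun _ => hc) n (wrapPt (M) ((Lc : ℤ) • y + toSite (ctrOff (d + 1) Lc))) : ↥(pbox (towerTorus Lc (M) n))) : Site (d + 1)) e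
                + evalN Lc M (fun _ => ctrOff (d + 1) Lc) n (fun z : Site (d + 1) => z) ((itRoot Lc (M) (fun _ => ctrOff (d + 1) Lc) (fun _ => hc) n (wrapPt (M) ((Lc : ℤ) • y + toSite (ctrOff (d + 1) Lc) + (Lc : ℤ) • unitVec μ)) : ↥(pbox (towerTorus Lc (M) n))) : Site (d + 1)) e)
              * symLinKerAt (toSite (ctrOff (d + 1) Lc)) Lc μ y (a.2, (a.1 : Site (d + 1))) / 2)))) = 0 := by
    ext a e
    simp only [Matrix.of_apply, Matrix.zero_apply, hz, hz', add_zero, zero_mul, zero_div, mul_zero, tsum_zero, Finset.sum_const_zero, neg_zero]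
  rw [h0, Matrix.mul_zero]

end Summit.QuantumFields.BalabanUV.Beta.FP.PeriodisedWardOrderOneTowerClosing

end
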